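import Summits.MatrixMultiplication.OmegaCensus.BoxIndependence
import Summits.MatrixMultiplication.OmegaCensus.DihC3SqCoord

/-!
# ω-census, family (b3): Conjecture C9 — the BOX-RATIO SECTION LAW (statement only)

HONEST FRAMING (pub-omega census; verbatim): lottery ticket; floor = certified bounds/negative ranges.  This file TYPES a
conjecture of the cell's STRUCTURE.md §2 (C9, registered 2026-08-25, RULING L24-13) as a `Prop`; it proves nothing and asserts
nothing; nothing here is progress on `ω`.

OBJECT.  For a finite group `G` and `3`-sets `Y, W ⊆ G`, a set of cells `I ⊆ G × Y × W` is *independent* when no ordered pair of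
distinct cells has trivial cell word (`ProductBoxBound.cellWord P P' = x x'⁻¹ (y y'⁻¹) (w w'⁻¹) ≠ 1`); `α(G) := α(G;|G|,3,3)` is the
largest independent set over all such boxes and `r(G) := α(G)/|G|` the *box ratio*.  A TPP triple `(S, T, U)` with `|T| = |U| = 3`
gives the independent set `S × T × U`, and Neumann's bound makes `G` useful for the census of two-`3`-set triples iff `r(G) < 9/5`
(`BoxUseful` below).

C9 (a) — PROVED mechanism (not typed here): `r` is monotone under sections, `r(H) ≤ r(G)` for subgroups (right-transversal lift;
TPP form `realizesTPP_index_mul_of_subgroup`, `SubgroupIndexTPP.lean`) and `r(G/N) ≤ r(G)` for quotients (TPP form: Cohn–Umans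
Lemma 2.2, `CohnUmans2003_lemma22`).
C9 (b) — THE CONJECTURE (`BoxRatioSectionLaw`): `r(G) < 9/5 ⟹ [G : Z(G)] ∈ {1, 4, 6}` or `G ∈ 𝒞₂` (the `Coord2` package of
`DihC3SqCoord`: `G = C₃² ⋊_ε C`, `C` abelian acting through `±1`).
C9 (c) — IDENTIFIED values (not typed): `r = 1, 3/2, 5/3, 16/9` on the four classes (kernel law rows R311
`CentreIndexFour.two_mul_volume_le_of_index_center`, NR154 `CentreIndexSix.three_mul_volume_le_of_index_center`, P-031.3b
`DihC3Sq.Coord2.nine_mul_volume_le` in filing; lower bounds by explicit boxes).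

EVIDENCE LEDGER (cell ids): every group of order `≤ 31` (P-028.5 sweep, kit j230106, table Pb67; the exception Dih(C₃²) = X-14
generated the class `𝒞₂`, prereg P-031); every group of order `32` (P-031.4′ HIT, kit j238403, Pb70: `r ∈ {1, 3/2, 2}` exactly);
order `36`: the two `𝒞₂` members at `64 = (16/9)·36` (P-031.2, kit j231379, Pb68); order `54`: `He₃ ⋊ C₂` (centre quotient
Dih(C₃²) but `G' = He₃`) has `r ≥ 2` (P-031.8 HIT), `D₅₄`, `Dih(C₃ × C₉)` have `r ≥ 2` (P-031.7 facts); counterexamples: none.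
FIRST SCHEDULED FALSIFICATION TESTS (prereg P-032, registered before any run): `S₃ × S₃` and `C₃² ⋊ C₄` (faithful action) at order
`36` — C9 predicts `α ≥ 65`, `α = 64` would be a fifth class at ratio `16/9`; `Dih(C₃³)` at order `54` (P-031.6 / P-032.3) — C9
predicts `α ≥ 98`; `D₃₄` — `α ≥ 62`.
-/

namespace Summit.MatrixMultiplication.OmegaCensus

open Finset

/-- A finite group is *box-useful* (for two-`3`-set TPP triples) when every independent cell set of every box `G × Y × W` with
`#Y = #W = 3` has fewer than `(9/5)·|G|` cells, i.e. `α(G;|G|,3,3) < 1.8·|G|` — below Neumann's bound `5|S| ≤ |G|`.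
(Census conjecture C9, pub-omega 2026-08-25; statement only.) -/
def BoxUseful (G : Type*) [Group G] [Fintype G] [DecidableEq G] : Prop :=
  ∀ Y W : Finset G, #Y = 3 → #W = 3 → ∀ I : Finset (G × G × G), I ⊆ univ ×ˢ (Y ×ˢ W) →
    (∀ P ∈ I, ∀ P' ∈ I, P ≠ P' → ProductBoxBound.cellWord P P' ≠ 1) → 5 * #I < 9 * Fintype.card G

/-- **Conjecture C9 (box-ratio section law; pub-omega census STRUCTURE.md §2, registered 2026-08-25).** A box-useful finite group
is abelian, or has centre of index `4` or `6`, or carries the `𝒞₂` coordinate package `DihC3Sq.Coord2` (`C₃² ⋊_ε C` with `C`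
abelian acting through `±1`).  OPEN; evidence ledger and scheduled tests in the module docstring.  Never to be asserted as a
theorem without proof (CONVENTIONS §4). -/
def BoxRatioSectionLaw : Prop :=
  ∀ (G : Type) [Group G] [Fintype G] [DecidableEq G], BoxUseful G →
    (Subgroup.center G).index = 1 ∨ (Subgroup.center G).index = 4 ∨ (Subgroup.center G).index = 6 ∨
      ∃ (c₁ c₂ : G) (κ₁ κ₂ ε : G → ZMod 3), DihC3Sq.Coord2 c₁ c₂ κ₁ κ₂ ε

end Summit.MatrixMultiplication.OmegaCensus
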